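/-
Copyright (c) 2026 the pub-hodgecm-mathlib formalisation cell (harness21).  Prover seat hodgecm-mathlib-LH7-p07 (g2) on the CHAIR K2-lead VALVE,
Track B «K2-LIT» ∕ hLiu418 #184♮ = `stmt-HodgeConjecture-24832`, Road I v3 U5 «THE CLOSE» — FACE-G organ (G-gen) = F4, road (E), brick (E-b) file 2
(F4 lead K2Liu-p27 (g2) MEMO `MEMO-F4-E-Interface` dea764ba §1 «(E-b) EXPORTS»; LEAD F0P6-plan (g14) BATCH #113 (2)(b); desk K2Liu-p10 (g6)).  THEOREMS ONLY.
-/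
import Summits.HodgeConjecture.HodgeConjecture.Theorems.K2LiuFockPActionLetters          -- (E-b) file 1: `lap_mul_of_const`, `lapS_contrS_mul`, `polFst_contr_mul`, `pPlus_binvPi`, …
import Literature.RepresentationTheory.KonnoKonno2007.JunctionSmoothOneParameter         -- ★ `hypOpGenC` (the boost generator as a `ℂ`-linear operator), `hypOpGenC_apply`
import HarnessLib

/-!
# Crux `HLiu418`, FACE-G organ (G-gen), road (E) brick (E-b) file 2: THE (E-c) LETTERS (hAm)(hAp) AND THE INTERTWINING (hBp)(hBm) DISCHARGED AT THE FOCK INSTANCE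

Cell `hodgecm-mathlib`, crux item hLiu418 = `stmt-HodgeConjecture-24832`; squad K2 ∕ K2Liu, F4 lead K2Liu-p27 (g2), desk K2Liu-p10 (g6); prover LH7-p07 (g2).
THEOREMS ONLY (no `def`, no instance, no notation, no named-fact hypothesis, no `sorry`); lane `--supports stmt-HodgeConjecture-24832 --as helper`.

WHY.  ★ (E-c) `K2LiuFockPBWInduction` (p862898) and ★ (E-f) `K2LiuLocalThetaCyclicUniform` (p862931) are GENERIC in `(CR CS : ι → A) (Ap Am : ι → A →ₗ[ℂ] A)
(B : A →ₗ[ℂ] V) (ωp ωm : ι → V →ₗ[ℂ] V)` and consume four by-value letters.  THIS FILE proves them at the junction Fock instance of `U(P,Q) × U(R,S)` (the F4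
place `σ` of signature `(p,q)` is `P = Q = Fin 2`, `|R| = p`, `|S| = q`), with EXPLICIT TERMS (def-free; a consumer `exact`s these theorems and unification fills the data):
`A := MvPolynomial (DPIdx P Q R S) ℂ`, `ι := P × Q`,
`CR i := Σ_r X (inl (inl (i.1,r))) * X (inr (inr (i.2,r)))` (the `R`-contraction of ★ `hypOpGen_sub_I_smul_rotBoostGen_binvPi`), `CS i := Σ_s X (inr (inl (i.1,s))) * X (inl (inr (i.2,s)))`,
`Ap i := (2π⁻¹i) • Σ_s ∂_{inr (inl (i.1,s))} ∘ ∂_{inl (inr (i.2,s))} − (2πi) • (CR i ·)` (the `𝔭⁺` symbol), `Am i := (2πi) • (CS i ·) − (2π⁻¹i) • Σ_r ∂∂` (the `𝔭⁻` symbol),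
`B := binvPiₗ`, `V := 𝓢(ℝ^{DPIdx})`, `ωp i := hypOpGenC − i·(μ₀(D_{π∕2}) ∘ hypOpGenC ∘ μ₀(D_{π∕2})⁻¹)` (★ `hypOpGen − i·rotBoostGen (π∕2)` as a `ℂ`-LINEAR map), `ωm i` with `+`.
* §0 tools: `pderiv_list_prod_eq_zero`, `mul_mem_span_of_forall`, `ite_mem`; §1 the `S`-coordinate instances of file 1's polarisation laws (`polPS_contrS_mul`,
  `polQS_contrS_mul`); §2 the `S`-derivatives kill `∏ C^R` and the `R`-derivatives kill `∏ C^S` (`pderiv_xS_prodCR`, …);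
* §3 LENGTH BOOKKEEPING on `S`-words: `polPS_prodCS_mem_span` ∕ `polQS_prodCS_mem_span` (`E(∏_τ C^S) ∈ span{∏_{τ′} C^S : |τ′| = |τ|}`) and **`lapS_prodCS_mem_span`**
  (`D^S_{ij}(∏_τ C^S) ∈ span{∏_{τ′} C^S : |τ′| < |τ|}` — file 1's `[D,C]` law iterated);
* §4 THE EXPORTS: **`am_prodCS`** = (hAm) with `c₃ = 2πi`; **`ap_prodCR_mul_prodCS_sub_mem_span`** = (hAp) with `c₁ = −2πi` (`neg_two_pi_I_ne_zero`; `c₃ ≠ 0` is Mathlib `Complex.two_pi_I_ne_zero`);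
  **`binvPi_ap`** = (hBp) and **`binvPi_am`** = (hBm) (★ symbols + ★ `hypOpGenC_apply` ∕ `rotBoostGen_apply`).
So ★ (E-f) `induction_on_kFinite` ∕ ★ (E-c) `induction_on_balanced_products` instantiate with `(hAm := am_prodCS R S) (hAp := ap_prodCR_mul_prodCS_sub_mem_span R S)
(hBp := binvPi_ap R S) (hBm := binvPi_am R S)`.  References: [Folland1989] §4.2 Prop. (4.39), §4.5; [KashiwaraVergne1978] §II.5; [Howe1989Remarks] §2–§3.
HONEST LABEL.  Count-neutral helper: `HC_CM` is proved only modulo the 7 printed citations (2 remaining named inputs: hLiu418 = `stmt-HodgeConjecture-24832`,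
h413 = `stmt-HodgeConjecture-24833`) until rung 0 closes; this file closes no socket.
-/

set_option autoImplicit false
set_option linter.dupNamespace false -- the mandated namespace repeats `HodgeConjecture.HodgeConjecture`

noncomputable section

open MvPolynomial Complex
open scoped Real
open Literature.Analysis.SegalBargmann
open Literature.RepresentationTheory.KonnoKonno2007.RealDualPair
open Summit.HodgeConjecture.HodgeConjecture.Cruxes.HLiu418.K2LiuFockPActionLetters

namespace Summit.HodgeConjecture.HodgeConjecture.Cruxes.HLiu418.K2LiuFockPActionExport

/-! ## §0 Tools -/

/-- a derivation killing every factor kills the product of a list. [folklore] -/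
theorem pderiv_list_prod_eq_zero {σ : Type*} (v : σ) :
    ∀ l : List (MvPolynomial σ ℂ), (∀ c ∈ l, pderiv v c = 0) → pderiv v l.prod = 0
  | [], _ => by rw [List.prod_nil, pderiv_one]
  | c :: l, h => by
    rw [List.prod_cons, pderiv_mul, h c List.mem_cons_self, pderiv_list_prod_eq_zero v l fun d hd => h d (List.mem_cons_of_mem c hd),
      zero_mul, mul_zero, add_zero]

/-- multiplying a span into a span: if `a·x ∈ span U` for every generator `x ∈ T`, then `a·x ∈ span U` for every `x ∈ span T`. [folklore] -/
theorem mul_mem_span_of_forall {A : Type*} [CommRing A] [Algebra ℂ A] (a : A) {T U : Set A} (hTU : ∀ x ∈ T, a * x ∈ Submodule.span ℂ U)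
    {x : A} (hx : x ∈ Submodule.span ℂ T) : a * x ∈ Submodule.span ℂ U := by
  have h := Submodule.mem_map_of_mem (f := LinearMap.mulLeft ℂ a) hx
  rw [Submodule.map_span] at h
  refine (Submodule.span_le.2 ?_) h
  rintro _ ⟨y, hy, rfl⟩
  exact hTU y hy

/-- `(if c then a else 0) ∈ M` as soon as `a ∈ M`. [folklore] -/
theorem ite_mem {A : Type*} [AddCommMonoid A] [Module ℂ A] {M : Submodule ℂ A} (c : Prop) [Decidable c] {a : A} (ha : a ∈ M) :
    (if c then a else 0) ∈ M := by
  split_ifs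
  · exact ha
  · exact M.zero_mem

/-- `−2πi ≠ 0` (the (hAp) constant `c₁`; `2πi ≠ 0` = the (hAm) constant `c₃` is Mathlib `Complex.two_pi_I_ne_zero`). [folklore] -/
theorem neg_two_pi_I_ne_zero : -(2 * π * I : ℂ) ≠ 0 := neg_ne_zero.2 Complex.two_pi_I_ne_zero

/-- `2π⁻¹i ≠ 0`. [folklore] -/
theorem two_pi_inv_I_ne_zero : (2 * (π : ℂ)⁻¹ * I : ℂ) ≠ 0 :=
  mul_ne_zero (mul_ne_zero two_ne_zero (inv_ne_zero (ofReal_ne_zero.2 Real.pi_ne_zero))) I_ne_zero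

section Poly

variable {P Q : Type*} (R S : Type*)

/-! ## §1 The `S`-coordinate instances of the polarisation laws -/

/-- **`[E^{P,S}, C^S]`**: `E^{P,S}_{ki}(C^S_{ab}·F) = C^S_{ab}·E^{P,S}_{ki}F + [i = a]·C^S_{kb}·F` (file 1 `polFst_contr_mul` at the `S`-planes). [cite: KashiwaraVergne1978, §II.5] -/
theorem polPS_contrS_mul [Fintype S] [DecidableEq P] [DecidableEq Q] [DecidableEq R] [DecidableEq S] (k i a : P) (b : Q)
    (F : MvPolynomial (DPIdx P Q R S) ℂ) :
    ∑ s : S, X (Sum.inr (Sum.inl (k, s))) * pderiv (Sum.inr (Sum.inl (i, s))) ((∑ s' : S, X (Sum.inr (Sum.inl (a, s'))) * X (Sum.inl (Sum.inr (b, s')))) * F) =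
      (∑ s' : S, X (Sum.inr (Sum.inl (a, s'))) * X (Sum.inl (Sum.inr (b, s')))) * (∑ s : S, X (Sum.inr (Sum.inl (k, s))) * pderiv (Sum.inr (Sum.inl (i, s))) F) +
        if i = a then (∑ s : S, X (Sum.inr (Sum.inl (k, s))) * X (Sum.inl (Sum.inr (b, s)))) * F else 0 :=
  polFst_contr_mul (fun p s => (Sum.inr (Sum.inl (p, s)) : DPIdx P Q R S)) (fun q s => Sum.inl (Sum.inr (q, s)))
    (fun i k t t' => xS_inj R S i k t t') (fun i j t t' => xS_ne_yS R S i j t t') k i a b F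

/-- **`[E^{Q,S}, C^S]`**: `E^{Q,S}_{lj}(C^S_{ab}·F) = C^S_{ab}·E^{Q,S}_{lj}F + [j = b]·C^S_{al}·F` (file 1 `polSnd_contr_mul` at the `S`-planes). [cite: KashiwaraVergne1978, §II.5] -/
theorem polQS_contrS_mul [Fintype S] [DecidableEq P] [DecidableEq Q] [DecidableEq R] [DecidableEq S] (l j : Q) (a : P) (b : Q)
    (F : MvPolynomial (DPIdx P Q R S) ℂ) :
    ∑ s : S, X (Sum.inl (Sum.inr (l, s))) * pderiv (Sum.inl (Sum.inr (j, s))) ((∑ s' : S, X (Sum.inr (Sum.inl (a, s'))) * X (Sum.inl (Sum.inr (b, s')))) * F) =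
      (∑ s' : S, X (Sum.inr (Sum.inl (a, s'))) * X (Sum.inl (Sum.inr (b, s')))) * (∑ s : S, X (Sum.inl (Sum.inr (l, s))) * pderiv (Sum.inl (Sum.inr (j, s))) F) +
        if j = b then (∑ s : S, X (Sum.inr (Sum.inl (a, s))) * X (Sum.inl (Sum.inr (l, s)))) * F else 0 :=
  polSnd_contr_mul (fun p s => (Sum.inr (Sum.inl (p, s)) : DPIdx P Q R S)) (fun q s => Sum.inl (Sum.inr (q, s)))
    (fun j l t t' => yS_inj R S j l t t') (fun i j t t' => xS_ne_yS R S i j t t') l j a b F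

/-! ## §2 The `S`-derivatives kill `∏ C^R`, the `R`-derivatives kill `∏ C^S` -/

/-- `∂_{(p,s)} ∏_ρ C^R = 0`. [folklore] -/
theorem pderiv_xS_prodCR [Fintype R] (p : P) (s : S) (ρ : List (P × Q)) :
    pderiv (Sum.inr (Sum.inl (p, s)) : DPIdx P Q R S)
      (ρ.map fun i : P × Q => (∑ r : R, X (Sum.inl (Sum.inl (i.1, r))) * X (Sum.inr (Sum.inr (i.2, r))) : MvPolynomial (DPIdx P Q R S) ℂ)).prod = 0 :=
  pderiv_list_prod_eq_zero _ _ fun c hc => by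
    obtain ⟨i, -, rfl⟩ := List.mem_map.1 hc
    exact pderiv_xS_contrR R S p s i.1 i.2

/-- `∂_{(q,s)} ∏_ρ C^R = 0`. [folklore] -/
theorem pderiv_yS_prodCR [Fintype R] (q : Q) (s : S) (ρ : List (P × Q)) :
    pderiv (Sum.inl (Sum.inr (q, s)) : DPIdx P Q R S)
      (ρ.map fun i : P × Q => (∑ r : R, X (Sum.inl (Sum.inl (i.1, r))) * X (Sum.inr (Sum.inr (i.2, r))) : MvPolynomial (DPIdx P Q R S) ℂ)).prod = 0 :=
  pderiv_list_prod_eq_zero _ _ fun c hc => by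
    obtain ⟨i, -, rfl⟩ := List.mem_map.1 hc
    exact pderiv_yS_contrR R S q s i.1 i.2

/-- `∂_{(q,r)} ∏_τ C^S = 0`. [folklore] -/
theorem pderiv_yR_prodCS [Fintype S] (q : Q) (r : R) (τ : List (P × Q)) :
    pderiv (Sum.inr (Sum.inr (q, r)) : DPIdx P Q R S)
      (τ.map fun i : P × Q => (∑ s : S, X (Sum.inr (Sum.inl (i.1, s))) * X (Sum.inl (Sum.inr (i.2, s))) : MvPolynomial (DPIdx P Q R S) ℂ)).prod = 0 :=
  pderiv_list_prod_eq_zero _ _ fun c hc => by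
    obtain ⟨i, -, rfl⟩ := List.mem_map.1 hc
    exact pderiv_yR_contrS R S q r i.1 i.2

/-- **`D^R` KILLS EVERY `S`-WORD**: `Σ_r ∂_{(p,r)}∂_{(q,r)} ∏_τ C^S = 0`. [cite: KashiwaraVergne1978, §II.5] -/
theorem lapR_prodCS [Fintype R] [Fintype S] (p : P) (q : Q) (τ : List (P × Q)) :
    ∑ r : R, pderiv (Sum.inl (Sum.inl (p, r)) : DPIdx P Q R S) (pderiv (Sum.inr (Sum.inr (q, r)))
      (τ.map fun i : P × Q => (∑ s : S, X (Sum.inr (Sum.inl (i.1, s))) * X (Sum.inl (Sum.inr (i.2, s))) : MvPolynomial (DPIdx P Q R S) ℂ)).prod) = 0 :=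
  Finset.sum_eq_zero fun r _ => by rw [pderiv_yR_prodCS, map_zero]

/-- **`D^S` PASSES THROUGH EVERY `R`-WORD**: `D^S_{pq}(∏_ρ C^R · F) = ∏_ρ C^R · D^S_{pq} F`. [cite: KashiwaraVergne1978, §II.5] -/
theorem lapS_prodCR_mul [Fintype R] [Fintype S] (p : P) (q : Q) (ρ : List (P × Q)) (F : MvPolynomial (DPIdx P Q R S) ℂ) :
    ∑ s : S, pderiv (Sum.inr (Sum.inl (p, s))) (pderiv (Sum.inl (Sum.inr (q, s)))
        ((ρ.map fun i : P × Q => (∑ r : R, X (Sum.inl (Sum.inl (i.1, r))) * X (Sum.inr (Sum.inr (i.2, r))) : MvPolynomial (DPIdx P Q R S) ℂ)).prod * F)) =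
      (ρ.map fun i : P × Q => (∑ r : R, X (Sum.inl (Sum.inl (i.1, r))) * X (Sum.inr (Sum.inr (i.2, r))) : MvPolynomial (DPIdx P Q R S) ℂ)).prod *
        ∑ s : S, pderiv (Sum.inr (Sum.inl (p, s))) (pderiv (Sum.inl (Sum.inr (q, s))) F) :=
  lap_mul_of_const (fun p s => (Sum.inr (Sum.inl (p, s)) : DPIdx P Q R S)) (fun q s => Sum.inl (Sum.inr (q, s))) p q
    (fun s => pderiv_xS_prodCR R S p s ρ) (fun s => pderiv_yS_prodCR R S q s ρ) F

/-! ## §3 Length bookkeeping on `S`-words -/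

/-- **`E^{P,S}` PRESERVES THE LENGTH OF `S`-WORDS**: `E^{P,S}_{ki}(∏_τ C^S) ∈ span {∏_{τ′} C^S : |τ′| = |τ|}`. [cite: Howe1989Remarks, §2] -/
theorem polPS_prodCS_mem_span [Fintype S] [DecidableEq P] [DecidableEq Q] [DecidableEq R] [DecidableEq S] (k i : P) :
    ∀ τ : List (P × Q),
      ∑ s : S, X (Sum.inr (Sum.inl (k, s))) * pderiv (Sum.inr (Sum.inl (i, s)) : DPIdx P Q R S)
          (τ.map fun i : P × Q => (∑ s : S, X (Sum.inr (Sum.inl (i.1, s))) * X (Sum.inl (Sum.inr (i.2, s))) : MvPolynomial (DPIdx P Q R S) ℂ)).prod ∈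
        Submodule.span ℂ {x : MvPolynomial (DPIdx P Q R S) ℂ | ∃ τ' : List (P × Q), τ'.length = τ.length ∧
          x = (τ'.map fun i : P × Q => (∑ s : S, X (Sum.inr (Sum.inl (i.1, s))) * X (Sum.inl (Sum.inr (i.2, s))) : MvPolynomial (DPIdx P Q R S) ℂ)).prod}
  | [] => by
    rw [List.map_nil, List.prod_nil, polFst_one (fun p s => (Sum.inr (Sum.inl (p, s)) : DPIdx P Q R S))]
    exact Submodule.zero_mem _
  | (a, b) :: τ => by
    simp only [List.map_cons, List.prod_cons]
    rw [polPS_contrS_mul]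
    refine Submodule.add_mem _ ?_ (ite_mem _ (Submodule.subset_span ⟨(k, b) :: τ, by simp, by simp only [List.map_cons, List.prod_cons]⟩))
    refine mul_mem_span_of_forall _ ?_ (polPS_prodCS_mem_span k i τ)
    rintro _ ⟨τ', hτ', rfl⟩
    exact Submodule.subset_span ⟨(a, b) :: τ', by simp [hτ'], by simp only [List.map_cons, List.prod_cons]⟩

/-- **`E^{Q,S}` PRESERVES THE LENGTH OF `S`-WORDS**: `E^{Q,S}_{lj}(∏_τ C^S) ∈ span {∏_{τ′} C^S : |τ′| = |τ|}`. [cite: Howe1989Remarks, §2] -/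
theorem polQS_prodCS_mem_span [Fintype S] [DecidableEq P] [DecidableEq Q] [DecidableEq R] [DecidableEq S] (l j : Q) :
    ∀ τ : List (P × Q),
      ∑ s : S, X (Sum.inl (Sum.inr (l, s))) * pderiv (Sum.inl (Sum.inr (j, s)) : DPIdx P Q R S)
          (τ.map fun i : P × Q => (∑ s : S, X (Sum.inr (Sum.inl (i.1, s))) * X (Sum.inl (Sum.inr (i.2, s))) : MvPolynomial (DPIdx P Q R S) ℂ)).prod ∈
        Submodule.span ℂ {x : MvPolynomial (DPIdx P Q R S) ℂ | ∃ τ' : List (P × Q), τ'.length = τ.length ∧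
          x = (τ'.map fun i : P × Q => (∑ s : S, X (Sum.inr (Sum.inl (i.1, s))) * X (Sum.inl (Sum.inr (i.2, s))) : MvPolynomial (DPIdx P Q R S) ℂ)).prod}
  | [] => by
    rw [List.map_nil, List.prod_nil, polSnd_one (fun q s => (Sum.inl (Sum.inr (q, s)) : DPIdx P Q R S))]
    exact Submodule.zero_mem _
  | (a, b) :: τ => by
    simp only [List.map_cons, List.prod_cons]
    rw [polQS_contrS_mul]
    refine Submodule.add_mem _ ?_ (ite_mem _ (Submodule.subset_span ⟨(a, l) :: τ, by simp, by simp only [List.map_cons, List.prod_cons]⟩))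
    refine mul_mem_span_of_forall _ ?_ (polQS_prodCS_mem_span l j τ)
    rintro _ ⟨τ', hτ', rfl⟩
    exact Submodule.subset_span ⟨(a, b) :: τ', by simp [hτ'], by simp only [List.map_cons, List.prod_cons]⟩

/-- **`D^S` SHORTENS `S`-WORDS**: `D^S_{ij}(∏_τ C^S) ∈ span {∏_{τ′} C^S : |τ′| < |τ|}` — file 1's `[D^S, C^S]` law iterated (the commutator terms are polarisations,
length-preserving on the tail, and the constant `|S|`). [cite: KashiwaraVergne1978, §II.5] [cite: Howe1989Remarks, §2–§3] -/
theorem lapS_prodCS_mem_span [Fintype S] [DecidableEq P] [DecidableEq Q] [DecidableEq R] [DecidableEq S] (i : P) (j : Q) :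
    ∀ τ : List (P × Q),
      ∑ s : S, pderiv (Sum.inr (Sum.inl (i, s)) : DPIdx P Q R S) (pderiv (Sum.inl (Sum.inr (j, s)))
          (τ.map fun i : P × Q => (∑ s : S, X (Sum.inr (Sum.inl (i.1, s))) * X (Sum.inl (Sum.inr (i.2, s))) : MvPolynomial (DPIdx P Q R S) ℂ)).prod) ∈
        Submodule.span ℂ {x : MvPolynomial (DPIdx P Q R S) ℂ | ∃ τ' : List (P × Q), τ'.length < τ.length ∧
          x = (τ'.map fun i : P × Q => (∑ s : S, X (Sum.inr (Sum.inl (i.1, s))) * X (Sum.inl (Sum.inr (i.2, s))) : MvPolynomial (DPIdx P Q R S) ℂ)).prod}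
  | [] => by
    rw [List.map_nil, List.prod_nil, lap_one (fun p s => (Sum.inr (Sum.inl (p, s)) : DPIdx P Q R S)) (fun q s => Sum.inl (Sum.inr (q, s)))]
    exact Submodule.zero_mem _
  | (a, b) :: τ => by
    simp only [List.map_cons, List.prod_cons]
    rw [lapS_contrS_mul]
    refine Submodule.add_mem _ (Submodule.add_mem _ (Submodule.add_mem _ ?_ (ite_mem _ ?_)) (ite_mem _ ?_)) (ite_mem _ ?_)
    · -- `C^S_{ab} · D^S(tail)`: one factor longer than a word strictly shorter than the tail
      refine mul_mem_span_of_forall _ ?_ (lapS_prodCS_mem_span i j τ)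
      rintro _ ⟨τ', hτ', rfl⟩
      exact Submodule.subset_span ⟨(a, b) :: τ', by simp only [List.length_cons]; omega, by simp only [List.map_cons, List.prod_cons]⟩
    · -- `E^{P,S}_{ai}(tail)`: same length as the tail
      refine Submodule.span_mono ?_ (polPS_prodCS_mem_span R S a i τ)
      rintro _ ⟨τ', hτ', rfl⟩
      exact ⟨τ', by simp [hτ'], rfl⟩
    · -- `E^{Q,S}_{bj}(tail)`
      refine Submodule.span_mono ?_ (polQS_prodCS_mem_span R S b j τ)
      rintro _ ⟨τ', hτ', rfl⟩
      exact ⟨τ', by simp [hτ'], rfl⟩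
    · -- `|S| • tail`
      exact Submodule.smul_mem _ _ (Submodule.subset_span ⟨τ, by simp, rfl⟩)

/-! ## §4 The (E-c) letters at the Fock instance -/

/-- **(hAm) AT THE FOCK INSTANCE** (`c₃ = 2πi`): on a pure `S`-word the `𝔭⁻` symbol `Am_{(p,q)} = 2πi·(C^S_{pq}·) − (2i∕π)·D^R_{pq}` is multiplication by `2πi·C^S_{pq}`
(`D^R` kills `S`-words). [cite: Folland1989, §4.2 Prop. (4.39)] [cite: KashiwaraVergne1978, §II.5] -/
theorem am_prodCS [Fintype R] [Fintype S] (τ : List (P × Q)) (i : P × Q) :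
    ((2 * π * I : ℂ) • LinearMap.mulLeft ℂ (∑ s : S, X (Sum.inr (Sum.inl (i.1, s))) * X (Sum.inl (Sum.inr (i.2, s))) : MvPolynomial (DPIdx P Q R S) ℂ) -
        (2 * (π : ℂ)⁻¹ * I : ℂ) • ∑ r : R, pderivLin (Sum.inl (Sum.inl (i.1, r)) : DPIdx P Q R S) ∘ₗ pderivLin (Sum.inr (Sum.inr (i.2, r))))
      (τ.map fun i : P × Q => (∑ s : S, X (Sum.inr (Sum.inl (i.1, s))) * X (Sum.inl (Sum.inr (i.2, s))) : MvPolynomial (DPIdx P Q R S) ℂ)).prod =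
    (2 * π * I : ℂ) • ((∑ s : S, X (Sum.inr (Sum.inl (i.1, s))) * X (Sum.inl (Sum.inr (i.2, s)))) *
      (τ.map fun i : P × Q => (∑ s : S, X (Sum.inr (Sum.inl (i.1, s))) * X (Sum.inl (Sum.inr (i.2, s))) : MvPolynomial (DPIdx P Q R S) ℂ)).prod) := by
  simp only [LinearMap.sub_apply, LinearMap.smul_apply, LinearMap.mulLeft_apply, LinearMap.sum_apply, LinearMap.comp_apply,
    pderivLin_apply, lapR_prodCS, smul_zero, sub_zero]

/-- **(hAp) AT THE FOCK INSTANCE** (`c₁ = −2πi`): `Ap_{(p,q)}(∏_ρ C^R · ∏_τ C^S) − (−2πi)·(C^R_{pq} · ∏_ρ C^R · ∏_τ C^S) = (2i∕π)·∏_ρ C^R · D^S_{pq}(∏_τ C^S)` lies in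
`span {∏_ρ C^R · ∏_{τ′} C^S : |τ′| < |τ|}`. [cite: Folland1989, §4.2 Prop. (4.39)] [cite: KashiwaraVergne1978, §II.5] [cite: Howe1989Remarks, §3] -/
theorem ap_prodCR_mul_prodCS_sub_mem_span [Fintype R] [Fintype S] [DecidableEq P] [DecidableEq Q] [DecidableEq R] [DecidableEq S]
    (ρ τ : List (P × Q)) (i : P × Q) :
    ((2 * (π : ℂ)⁻¹ * I : ℂ) • (∑ s : S, pderivLin (Sum.inr (Sum.inl (i.1, s)) : DPIdx P Q R S) ∘ₗ pderivLin (Sum.inl (Sum.inr (i.2, s)))) -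
          (2 * π * I : ℂ) • LinearMap.mulLeft ℂ (∑ r : R, X (Sum.inl (Sum.inl (i.1, r))) * X (Sum.inr (Sum.inr (i.2, r))) : MvPolynomial (DPIdx P Q R S) ℂ))
        ((ρ.map fun i : P × Q => (∑ r : R, X (Sum.inl (Sum.inl (i.1, r))) * X (Sum.inr (Sum.inr (i.2, r))) : MvPolynomial (DPIdx P Q R S) ℂ)).prod *
          (τ.map fun i : P × Q => (∑ s : S, X (Sum.inr (Sum.inl (i.1, s))) * X (Sum.inl (Sum.inr (i.2, s))) : MvPolynomial (DPIdx P Q R S) ℂ)).prod) -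
      (-(2 * π * I : ℂ)) • ((∑ r : R, X (Sum.inl (Sum.inl (i.1, r))) * X (Sum.inr (Sum.inr (i.2, r)))) *
        (ρ.map fun i : P × Q => (∑ r : R, X (Sum.inl (Sum.inl (i.1, r))) * X (Sum.inr (Sum.inr (i.2, r))) : MvPolynomial (DPIdx P Q R S) ℂ)).prod *
          (τ.map fun i : P × Q => (∑ s : S, X (Sum.inr (Sum.inl (i.1, s))) * X (Sum.inl (Sum.inr (i.2, s))) : MvPolynomial (DPIdx P Q R S) ℂ)).prod) ∈
    Submodule.span ℂ {x : MvPolynomial (DPIdx P Q R S) ℂ | ∃ τ' : List (P × Q), τ'.length < τ.length ∧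
      x = (ρ.map fun i : P × Q => (∑ r : R, X (Sum.inl (Sum.inl (i.1, r))) * X (Sum.inr (Sum.inr (i.2, r))) : MvPolynomial (DPIdx P Q R S) ℂ)).prod *
        (τ'.map fun i : P × Q => (∑ s : S, X (Sum.inr (Sum.inl (i.1, s))) * X (Sum.inl (Sum.inr (i.2, s))) : MvPolynomial (DPIdx P Q R S) ℂ)).prod} := by
  simp only [LinearMap.sub_apply, LinearMap.smul_apply, LinearMap.mulLeft_apply, LinearMap.sum_apply, LinearMap.comp_apply,
    pderivLin_apply, lapS_prodCR_mul, neg_smul, sub_neg_eq_add, mul_assoc, sub_add_cancel]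
  refine Submodule.smul_mem _ _ (mul_mem_span_of_forall _ ?_ (lapS_prodCS_mem_span R S i.1 i.2 τ))
  rintro _ ⟨τ', hτ', rfl⟩
  exact Submodule.subset_span ⟨τ', hτ', rfl⟩

end Poly

/-! ## §5 The intertwining with the `ℂ`-linear Schwartz operators of the ★ symbols -/

section Bridge

variable {P Q : Type*} [Fintype P] [DecidableEq P] [Fintype Q] [DecidableEq Q]
  (R S : Type*) [Fintype R] [DecidableEq R] [Fintype S] [DecidableEq S]

/-- **(hBp) AT THE FOCK INSTANCE**: `B(Ap_{(p,q)} F) = ωp_{(p,q)}(B F)` with `B = binvPiₗ` and `ωp = hypOpGenC − i·(μ₀(D_{π∕2}) ∘ hypOpGenC ∘ μ₀(D_{π∕2})⁻¹)`, the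
`ℂ`-linear form of ★ `hypOpGen − i·rotBoostGen (π∕2)` (file 1 `pPlus_binvPi`). [cite: Folland1989, §4.2 Prop. (4.39)] -/
theorem binvPi_ap (i : P × Q) (F : MvPolynomial (DPIdx P Q R S) ℂ) :
    binvPiₗ (((2 * (π : ℂ)⁻¹ * I : ℂ) • (∑ s : S, pderivLin (Sum.inr (Sum.inl (i.1, s)) : DPIdx P Q R S) ∘ₗ pderivLin (Sum.inl (Sum.inr (i.2, s)))) -
          (2 * π * I : ℂ) • LinearMap.mulLeft ℂ (∑ r : R, X (Sum.inl (Sum.inl (i.1, r))) * X (Sum.inr (Sum.inr (i.2, r))) : MvPolynomial (DPIdx P Q R S) ℂ)) F) =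
      ((hypOpGenC R S i.1 i.2 : SchwartzMap (DPIdx P Q R S → ℝ) ℂ →L[ℂ] SchwartzMap (DPIdx P Q R S → ℝ) ℂ) -
            I • ((unitaryOpPi (phaseU R S i.1 (π / 2))).comp ((hypOpGenC R S i.1 i.2).comp (unitaryOpPi (phaseU R S i.1 (π / 2))⁻¹)))).toLinearMap
        (binvPiₗ F) := by
  simp only [binvPiₗ_apply, LinearMap.sub_apply, LinearMap.smul_apply, LinearMap.mulLeft_apply, LinearMap.sum_apply, LinearMap.comp_apply,
    pderivLin_apply]
  rw [ContinuousLinearMap.coe_coe, sub_apply, smul_apply, ContinuousLinearMap.comp_apply, ContinuousLinearMap.comp_apply, hypOpGenC_apply,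
    hypOpGenC_apply, ← rotBoostGen_apply, pPlus_binvPi]

/-- **(hBm) AT THE FOCK INSTANCE**: `B(Am_{(p,q)} F) = ωm_{(p,q)}(B F)`, `ωm = hypOpGenC + i·(μ₀(D_{π∕2}) ∘ hypOpGenC ∘ μ₀(D_{π∕2})⁻¹)` (file 1 `pMinus_binvPi`).
[cite: Folland1989, §4.2 Prop. (4.39)] -/
theorem binvPi_am (i : P × Q) (F : MvPolynomial (DPIdx P Q R S) ℂ) :
    binvPiₗ (((2 * π * I : ℂ) • LinearMap.mulLeft ℂ (∑ s : S, X (Sum.inr (Sum.inl (i.1, s))) * X (Sum.inl (Sum.inr (i.2, s))) : MvPolynomial (DPIdx P Q R S) ℂ) -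
          (2 * (π : ℂ)⁻¹ * I : ℂ) • ∑ r : R, pderivLin (Sum.inl (Sum.inl (i.1, r)) : DPIdx P Q R S) ∘ₗ pderivLin (Sum.inr (Sum.inr (i.2, r)))) F) =
      ((hypOpGenC R S i.1 i.2 : SchwartzMap (DPIdx P Q R S → ℝ) ℂ →L[ℂ] SchwartzMap (DPIdx P Q R S → ℝ) ℂ) +
            I • ((unitaryOpPi (phaseU R S i.1 (π / 2))).comp ((hypOpGenC R S i.1 i.2).comp (unitaryOpPi (phaseU R S i.1 (π / 2))⁻¹)))).toLinearMap
        (binvPiₗ F) := by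
  simp only [binvPiₗ_apply, LinearMap.sub_apply, LinearMap.smul_apply, LinearMap.mulLeft_apply, LinearMap.sum_apply, LinearMap.comp_apply,
    pderivLin_apply]
  rw [ContinuousLinearMap.coe_coe, add_apply, smul_apply, ContinuousLinearMap.comp_apply, ContinuousLinearMap.comp_apply, hypOpGenC_apply,
    hypOpGenC_apply, ← rotBoostGen_apply, pMinus_binvPi]

end Bridge

end Summit.HodgeConjecture.HodgeConjecture.Cruxes.HLiu418.K2LiuFockPActionExport

end
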